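import Mathlib
import Summits.ValiantsHypothesis.ValiantsHypothesis.Theses.ProofCarryingSymmetry
import Summits.ValiantsHypothesis.ValiantsHypothesis.Theorems.ProofCarryingSymmetryAssembly
import Literature.Computability.AlgebraicComplexity.DawarWilsenach2025Thm71

/-!
# Route ProofCarryingSymmetry, crux `RestorationQP` — `¬ RestorationQP` MODULO an arithmetic CFI family

Lead c3 (line `registered`), negative side.  The route's own kill criterion for the crux ("an explicit
diagonally invariant VP family with no `2^{polylog}` symmetric circuits … Boolean precedent P ≠ FPC")
made formal with the tree's PROVED Dawar–Wilsenach pipeline (Thm. 5.1 `DawarWilsenach2025_thm51_family`: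
symmetric arithmetic circuits of orbit size `2^{o(n)}` ⇒ symmetric threshold circuits of orbit size
`2^{o(n)}` deciding the level sets on `0/1` matrices; Thm. 6.4
`DawarWilsenach2025_orbitSize_countingWidth_holds`: such circuits decide only classes of counting width
`o(n)`):

* `eval_adj_eq_eventually_of_isSymmetric_subexp` — the engine, for ANY polynomial family: `S_n`-symmetric
  labelled circuits of size `2^{o(n)}` force, for every `ε > 0` and all large `n`, equal values at the
  adjacency matrices of `≡^{C^k}`-equivalent `n`-vertex graphs whenever `k ≥ εn`;
* `ArithmeticCFI` — THE MISSING CONSTRUCTION: a diagonally `S_n`-invariant VP family over `ℂ` whose values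
  at adjacency matrices separate, for some `ε > 0` and infinitely many `n`, a pair of `≡^{C^k}`-equivalent
  `n`-vertex graphs with `k ≥ εn` (an arithmetic analogue of the Cai–Fürer–Immerman graphs: for the
  PERMANENT such pairs exist — Dawar–Wilsenach Thm. 7.2, `CFIMatching.DawarWilsenach2025_thm72_family` — but
  the permanent is not known to be in VP; no VP example is known, Dwivedi–Pago–Seppelt 2026 Outlook Q3);
* `RestorationQP_false_of_ArithmeticCFI : ArithmeticCFI → ¬ RestorationQP` — quasi-polynomial size is
  `2^{o(n)}` (`natLog_add_pow_lt_mul_eventually` of the route's assembly file), so the engine applies to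
  the circuits the crux would supply.

Everything here is proved; the item stays open (this is `¬ crux` modulo the construction `ArithmeticCFI`).
-/

-- single-problem summit: `Summit.ValiantsHypothesis.ValiantsHypothesis.…` is the namespace by design (D-0017)
set_option linter.dupNamespace false

noncomputable section

open scoped Classical

namespace Summit.ValiantsHypothesis.ValiantsHypothesis.Theorems

open Filter
open Literature.Computability.AlgebraicComplexity
open Literature.ModelTheory.FiniteModelTheory
open Literature.Computability.Complexity (Circuit tcBasis)

/-- **The engine: sub-exponential symmetric circuits cannot separate graphs of linear counting
width.**  If `p_n ∈ ℂ[x_ij]` is computed by `S_n`-symmetric labelled circuits with at most `2^{o(n)}`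
gates (for every `ε > 0`, eventually `≤ 2^{εn}`), then for every `ε > 0` and all large `n`, `p_n` takes
the same value at the adjacency matrices of any two `≡^{C^k}`-equivalent graphs on `Fin n` with
`k ≥ εn` (stated against a reference family `X n`).  Proof: the Dawar–Wilsenach deduction of Thm. 7.1
(p. 19) with the permanent replaced by `p` — Thm. 5.1 turns the circuits into symmetric threshold
circuits of orbit size `2^{o(n)}` deciding the class `{Γ : p(Γ) = p(X_{|Γ|})}`, which by Thm. 6.4 is
eventually `≡^{C^k}`-invariant for `k ≥ εn`. [cite: DawarWilsenach2025, §7.1 (proof of Thm. 7.1, p. 19)] -/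
theorem eval_adj_eq_eventually_of_isSymmetric_subexp
    (p : (n : ℕ) → MvPolynomial (Fin n × Fin n) ℂ)
    (G : ℕ → Type) [∀ n, Fintype (G n)]
    (D : ∀ n, LabelledArithCircuit ℂ (Fin n × Fin n) Unit (G n))
    (hsym : ∀ n, (D n).IsSymmetric (Equiv.Perm (Fin n)))
    (hev : ∀ n, (D n).eval ((D n).output ()) = p n)
    (hsmall : ∀ ε : ℝ, 0 < ε → ∀ᶠ n : ℕ in atTop,
      (Fintype.card (G n) : ℝ) ≤ (2 : ℝ) ^ (ε * (n : ℝ)))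
    (X : ∀ n, SimpleGraph (Fin n)) {ε : ℝ} (hε : 0 < ε) :
    ∀ᶠ n : ℕ in atTop, ∀ k : ℕ, ε * (n : ℝ) ≤ (k : ℝ) →
      ∀ Y : SimpleGraph (Fin n), CkEquiv k (X n) Y →
        MvPolynomial.eval (fun ij : Fin n × Fin n => if Y.Adj ij.1 ij.2 then (1 : ℂ) else 0) (p n) =
          MvPolynomial.eval (fun ij : Fin n × Fin n => if (X n).Adj ij.1 ij.2 then (1 : ℂ) else 0)
            (p n) := by
  -- orbit size `2^{o(n)}` (an orbit is a set of gates)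
  have horb : ∀ δ : ℝ, 0 < δ → ∀ᶠ n : ℕ in atTop,
      ((D n).orbitSize (Equiv.Perm (Fin n)) : ℝ) ≤ (2 : ℝ) ^ (δ * (n : ℝ)) := fun δ hδ =>
    (hsmall δ hδ).mono fun n hn =>
      le_trans (by exact_mod_cast (D n).orbitSize_le_size (Equiv.Perm (Fin n))) hn
  -- Boolean adjacency matrices, values at them, the level sets `S_n = {p_n(X_n)}`, the class `𝒞`
  let adjB : ∀ n, SimpleGraph (Fin n) → Fin n × Fin n → Bool := fun n Γ ij =>
    decide (Γ.Adj ij.1 ij.2)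
  let val : ∀ n, (Fin n × Fin n → Bool) → ℂ := fun n A =>
    MvPolynomial.eval (fun ij => if A ij = true then (1 : ℂ) else 0) (p n)
  have hval : ∀ (n : ℕ) (Γ : SimpleGraph (Fin n)), val n (adjB n Γ) =
      MvPolynomial.eval (fun ij : Fin n × Fin n => if Γ.Adj ij.1 ij.2 then (1 : ℂ) else 0)
        (p n) := by
    intro n Γ
    have hfun : (fun ij : Fin n × Fin n => if decide (Γ.Adj ij.1 ij.2) = true then (1 : ℂ) else 0) =
        fun ij => if Γ.Adj ij.1 ij.2 then (1 : ℂ) else 0 := by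
      funext ij
      by_cases h : Γ.Adj ij.1 ij.2 <;> simp [h]
    simp only [val, adjB]
    rw [hfun]
  let S : ℕ → Set ℂ := fun n => {val n (adjB n (X n))}
  let 𝒞 : Set FinGraph := {Γ | val Γ.1 (adjB Γ.1 Γ.2) ∈ S Γ.1}
  -- Theorem 5.1: symmetric threshold circuits of orbit size `2^{o(n)}` deciding `𝒞`
  obtain ⟨Ψ, hΨ, hΨorb, hΨeval⟩ :=
    DawarWilsenach2025_thm51_family ℂ G D S hsym (fun n => Set.finite_singleton _) horb
  have hdec : DecidesGraphClass 𝒞 Ψ := by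
    intro n Γ _
    rw [hΨeval n (adjInput Γ), hev n]
    have hA : adjInput Γ = adjB n Γ := by
      funext ij
      simp [adjInput_apply, adjB]
    rw [hA]
    exact Iff.rfl
  -- Theorem 6.4: `𝒞` is eventually `≡^{C^k}`-invariant for `k ≥ εn`
  have hinv := DawarWilsenach2025_orbitSize_countingWidth_holds 𝒞 Ψ hΨ hdec hΨorb ε hε
  refine hinv.mono fun n hn k hk Y hXY => ?_
  have hX : (⟨n, X n⟩ : FinGraph) ∈ 𝒞 := by
    show val n (adjB n (X n)) ∈ S n
    exact Set.mem_singleton _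
  have hY : val n (adjB n Y) ∈ S n := (hn k hk (X n) Y hXY).mp hX
  rw [Set.mem_singleton_iff, hval, hval] at hY
  exact hY

/-- **ARITHMETIC CFI FAMILY** — the construction a refutation of `RestorationQP` by counting width
needs (the route's kill criterion; Boolean precedent: the Cai–Fürer–Immerman query is in P but not in
FPC).  A family `f_n ∈ ℂ[x_ij : i, j < n]`, invariant under the diagonal relabelling `x_ij ↦ x_{σ i, σ j}`
and in VP (`IsVPFamily`), together with `ε > 0` such that for infinitely many `n` some two
`≡^{C^k}`-equivalent graphs on `Fin n` with `k ≥ εn` (`CkEquiv`, Hella's bijective `k`-pebble game) get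
DIFFERENT values of `f_n` at their adjacency matrices.  For the permanent such pairs exist
(Dawar–Wilsenach Thm. 7.2) but `per ∈ VP` is Valiant's hypothesis negated; no VP example is known.
[conjecture-grade: DwivediPagoSeppelt2026 Outlook Q3; DawarWilsenach2025 §7] -/
def ArithmeticCFI : Prop :=
  ∃ f : (n : ℕ) → MvPolynomial (Fin n × Fin n) ℂ,
    (∀ (n : ℕ) (σ : Equiv.Perm (Fin n)),
      MvPolynomial.rename (fun x : Fin n × Fin n => σ • x) (f n) = f n) ∧
    IsVPFamily f ∧
    ∃ ε : ℝ, 0 < ε ∧ ∃ᶠ n : ℕ in atTop, ∃ k : ℕ, ε * (n : ℝ) ≤ (k : ℝ) ∧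
      ∃ X Y : SimpleGraph (Fin n), CkEquiv k X Y ∧
        MvPolynomial.eval (fun ij : Fin n × Fin n => if X.Adj ij.1 ij.2 then (1 : ℂ) else 0) (f n) ≠
          MvPolynomial.eval (fun ij : Fin n × Fin n => if Y.Adj ij.1 ij.2 then (1 : ℂ) else 0) (f n)

/-- **`ArithmeticCFI → ¬ RestorationQP`** (the crux refuted MODULO the construction): symmetry
restoration at quasi-polynomial cost would give the arithmetic CFI family `S_n`-symmetric circuits of
size `≤ 2^{(log₂ n + c)^c} = 2^{o(n)}` (`natLog_add_pow_lt_mul_eventually`), which by the engine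
(`eval_adj_eq_eventually_of_isSymmetric_subexp`, Dawar–Wilsenach Thms. 5.1 and 6.4) cannot separate
`≡^{C^{εn}}`-equivalent graphs for large `n` — against the separation infinitely often. [folklore] -/
theorem RestorationQP_false_of_ArithmeticCFI :
    ArithmeticCFI →
      ¬ Summit.ValiantsHypothesis.ValiantsHypothesis.Theses.ProofCarryingSymmetry.RestorationQP := by
  rintro ⟨f, hinv, hVP, ε, hε, hfreq⟩ hR
  obtain ⟨c, hc⟩ := hR f hinv hVP
  choose G hG D hsym hev hcard using hc
  -- quasi-polynomial size is `2^{o(n)}`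
  have hsmall : ∀ δ : ℝ, 0 < δ → ∀ᶠ n : ℕ in atTop,
      (Fintype.card (G n) : ℝ) ≤ (2 : ℝ) ^ (δ * (n : ℝ)) := by
    intro δ hδ
    obtain ⟨n₀, hn₀⟩ :=
      Summit.ValiantsHypothesis.Theorems.ProofCarryingSymmetry.natLog_add_pow_lt_mul_eventually c hδ
    refine Filter.eventually_atTop.2 ⟨n₀, fun n hn => ?_⟩
    calc (Fintype.card (G n) : ℝ) ≤ (2 : ℝ) ^ (((Nat.log 2 n + c) ^ c : ℕ) : ℝ) := by
          rw [Real.rpow_natCast]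
          exact_mod_cast hcard n
      _ ≤ (2 : ℝ) ^ (δ * (n : ℝ)) := Real.rpow_le_rpow_of_exponent_le one_le_two (hn₀ n hn).le
  -- the separating data, chosen where it exists; the reference graphs `X n`
  let val : ∀ n, SimpleGraph (Fin n) → ℂ := fun n Γ =>
    MvPolynomial.eval (fun ij : Fin n × Fin n => if Γ.Adj ij.1 ij.2 then (1 : ℂ) else 0) (f n)
  let P : ℕ → Prop := fun n => ∃ k : ℕ, ε * (n : ℝ) ≤ (k : ℝ) ∧
    ∃ X Y : SimpleGraph (Fin n), CkEquiv k X Y ∧ val n X ≠ val n Y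
  have hP : ∃ᶠ n : ℕ in atTop, P n := hfreq
  let X : ∀ n, SimpleGraph (Fin n) := fun n =>
    if h : P n then h.choose_spec.2.choose else ⊥
  have hmain := eval_adj_eq_eventually_of_isSymmetric_subexp f G D hsym hev hsmall X hε
  obtain ⟨n, hn, hPn⟩ := (hmain.and_frequently hP).exists
  have hXn : X n = hPn.choose_spec.2.choose := dif_pos hPn
  obtain ⟨Y, hXY, hne⟩ := hPn.choose_spec.2.choose_spec
  have heq := hn hPn.choose hPn.choose_spec.1 Y (hXn ▸ hXY)
  rw [hXn] at heq
  exact hne heq.symm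

end Summit.ValiantsHypothesis.ValiantsHypothesis.Theorems

end
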